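import Summits.Ventures.PackingBounds.Configurations.CohnLiVectors

/-!
# Cohn–Li in dimension `17`, II: signed pattern vectors in `ℤ²⁴` and their inner products

Framing: lottery ticket; floor = certified bounds/negative ranges. Venture `PackingBounds` (cell
`pub-packcert`, seat `pub-packcert-energy`).

Integer model of `ℝ^{4×4} × ℝ` (Cohn–Li 2024, §3) inside `ℤ²⁴`, scaled by `3`: a vector `(x, t√2)` with
`x ∈ ℤ¹⁶` is stored as `(x₀, …, x₁₅, t, t, 0, …, 0)`, so that the tree's integer inner product `ip` on `ℤ²⁴`
IS the inner product of `ℝ¹⁷` (`2 t t'` from the two copies of the `√2`-axis) and the configuration lies in the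
`17`-dimensional subspace `{y₁₆ = y₁₇, y₁₈ = ⋯ = y₂₃ = 0}`. Every vector of the configuration is a *pattern
vector* `pvec S f a e`: value `a · sgn (f j)` on the cells `j ∈ S ⊆ {0, …, 15}`, value `e` on the two axis
coordinates `16, 17`, and `0` elsewhere:
* shape `A` (`480`): `S = {k, l}`, `a = 6`, `e = 0`;
* shape `B` (`3840`): `S` = a pair or square of `C₆`, `a = 3`, odd sign pattern, `e = 0`;
* shape `X` (`1024`): `S` = a cross, `a = 3`, odd sign pattern, `e = ±3`;
* shape `T` (`2`): `S = ∅`, `e = ±6`;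
* shape `D` (`384`, the added deep holes): `S` = all `16` cells, `a = 2`, signs of a word of `C⁺ ∪ C⁻`, `e = ±2`.
This file proves the one inner-product formula
`ip (pvec S f a e) (pvec S' f' a' e') = a a' (|S ∩ S'| − 2 D) + 2 e e'`, `D = #{j ∈ S ∩ S' : f j ≠ f' j}`,
the norm `a² |S| + 2 e²`, and the three generic bounds used for the `15` shape pairs (intersection bound, same
support with two odd patterns, odd pattern against an even one). Data and kernel facts: `CL17Codes.lean`; the
count `5730` and the transfer to `ℝ¹⁷`: `CL17.lean`.

## References
* H. Cohn, A. Li, *Improved kissing numbers in seventeen through twenty-one dimensions*, arXiv:2411.04916 (2024), §3. [`CohnLi2024`]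
-/

namespace Summit.Ventures.PackingBounds.Config.CL17

open Finset Leech Golay

/-! ### Sign counts on a `Finset` -/

/-- Sum of signs over a finite set = size minus twice the number of minus signs. -/
theorem sum_sgn_finset (S : Finset (Fin 24)) (g : Fin 24 → Bool) :
    ∑ j ∈ S, sgn (g j) = (S.card : ℤ) - 2 * ((S.filter fun j => g j = true).card : ℤ) := by
  simp only [sgn_eq, Finset.sum_sub_distrib, Finset.sum_const, nsmul_eq_mul, mul_one, ← Finset.mul_sum]
  rw [Finset.natCast_card_filter]

/-- `#{f ⊕ g} + 2 #{f ∧ g} = #{f} + #{g}` on a finite set. -/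
theorem card_filter_xor_add_finset (S : Finset (Fin 24)) (f g : Fin 24 → Bool) :
    (S.filter fun i => (f i ^^ g i) = true).card + 2 * (S.filter fun i => (f i && g i) = true).card =
      (S.filter fun i => f i = true).card + (S.filter fun i => g i = true).card := by
  rw [Finset.card_filter, Finset.card_filter, Finset.card_filter, Finset.card_filter, Finset.mul_sum,
    ← Finset.sum_add_distrib, ← Finset.sum_add_distrib]
  refine Finset.sum_congr rfl fun i _ => ?_
  cases f i <;> cases g i <;> rfl

/-- Two odd sign counts differ on an even number of places. -/
theorem even_card_filter_xor_of_odd_finset {S : Finset (Fin 24)} {f g : Fin 24 → Bool}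
    (hf : Odd (S.filter fun i => f i = true).card) (hg : Odd (S.filter fun i => g i = true).card) :
    Even (S.filter fun i => (f i ^^ g i) = true).card := by
  have h := card_filter_xor_add_finset S f g
  obtain ⟨a, ha⟩ := hf; obtain ⟨b, hb⟩ := hg
  exact ⟨a + b + 1 - (S.filter fun i => (f i && g i) = true).card, by omega⟩

/-- An odd and an even sign count differ on an odd number of places. -/
theorem odd_card_filter_xor_finset {S : Finset (Fin 24)} {f g : Fin 24 → Bool}
    (hf : Odd (S.filter fun i => f i = true).card) (hg : Even (S.filter fun i => g i = true).card) :
    Odd (S.filter fun i => (f i ^^ g i) = true).card := by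
  have h := card_filter_xor_add_finset S f g
  obtain ⟨a, ha⟩ := hf; obtain ⟨b, hb⟩ := hg
  exact ⟨a + b - (S.filter fun i => (f i && g i) = true).card, by omega⟩

/-! ### The cells and the axis -/

/-- The `16` matrix cells: coordinates `< 16` of `ℤ²⁴`. -/
def cells : Finset (Fin 24) := univ.filter fun j => j.val < 16

/-- Membership in `cells`. -/
@[simp] theorem mem_cells {j : Fin 24} : j ∈ cells ↔ j.val < 16 := by simp [cells]

/-- There are `16` cells. -/
theorem card_cells : cells.card = 16 := by decide

/-- **Pattern vector**: `a · sgn (f j)` on the cells `j ∈ S`, `e` on the two axis coordinates `16, 17` (the two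
copies of the `√2`-axis of `ℝ^{4×4} × ℝ`), `0` elsewhere. [cite: CohnLi2024, §3] -/
def pvec (S : Finset (Fin 24)) (f : Fin 24 → Bool) (a e : ℤ) : Fin 24 → ℤ :=
  fun j => (if j ∈ S then a * sgn (f j) else 0) + ((if j = 16 then e else 0) + (if j = 17 then e else 0))

/-- Testing a vector against a pattern vector. -/
theorem ip_pvec (x : Fin 24 → ℤ) (S : Finset (Fin 24)) (f : Fin 24 → Bool) (a e : ℤ) :
    ip x (pvec S f a e) = (∑ j ∈ S, x j * (a * sgn (f j))) + e * (x 16 + x 17) := by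
  simp only [ip, pvec, mul_add, Finset.sum_add_distrib, mul_ite, mul_zero, Finset.sum_ite_mem, Finset.univ_inter,
    Finset.sum_ite_eq', Finset.mem_univ, if_true]
  ring

/-- A cell is not an axis coordinate. -/
theorem ne_axis_of_lt {j : Fin 24} (hj : j.val < 16) : j ≠ 16 ∧ j ≠ 17 := by
  constructor <;> (intro h; rw [h] at hj; exact absurd hj (by decide))

/-- Value of a pattern vector on a cell. -/
theorem pvec_apply_of_lt (S : Finset (Fin 24)) (f : Fin 24 → Bool) (a e : ℤ) {j : Fin 24} (hj : j.val < 16) :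
    pvec S f a e j = if j ∈ S then a * sgn (f j) else 0 := by
  obtain ⟨h16, h17⟩ := ne_axis_of_lt hj
  simp [pvec, h16, h17]

/-- Value on the first axis coordinate. -/
theorem pvec_apply_16 {S : Finset (Fin 24)} (hS : S ⊆ cells) (f : Fin 24 → Bool) (a e : ℤ) :
    pvec S f a e 16 = e := by
  have h : (16 : Fin 24) ∉ S := fun h => absurd (mem_cells.mp (hS h)) (by decide)
  simp [pvec, h, show (16 : Fin 24) ≠ 17 by decide]

/-- Value on the second axis coordinate. -/
theorem pvec_apply_17 {S : Finset (Fin 24)} (hS : S ⊆ cells) (f : Fin 24 → Bool) (a e : ℤ) :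
    pvec S f a e 17 = e := by
  have h : (17 : Fin 24) ∉ S := fun h => absurd (mem_cells.mp (hS h)) (by decide)
  simp [pvec, h, show (17 : Fin 24) ≠ 16 by decide]

/-- A pattern vector vanishes beyond coordinate `17`. -/
theorem pvec_apply_ge {S : Finset (Fin 24)} (hS : S ⊆ cells) (f : Fin 24 → Bool) (a e : ℤ) {j : Fin 24}
    (hj : 18 ≤ j.val) : pvec S f a e j = 0 := by
  have h1 : j ∉ S := fun h => by have := mem_cells.mp (hS h); omega
  have h16 : j ≠ 16 := by intro h; rw [h] at hj; exact absurd hj (by decide)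
  have h17 : j ≠ 17 := by intro h; rw [h] at hj; exact absurd hj (by decide)
  simp [pvec, h1, h16, h17]

/-- The two axis coordinates of a pattern vector agree. -/
theorem pvec_apply_16_eq_17 {S : Finset (Fin 24)} (hS : S ⊆ cells) (f : Fin 24 → Bool) (a e : ℤ) :
    pvec S f a e 16 = pvec S f a e 17 := by
  rw [pvec_apply_16 hS, pvec_apply_17 hS]

/-- Absolute value of a pattern vector on a cell is `≤ |a|`. -/
theorem abs_pvec_apply_le {S : Finset (Fin 24)} (f : Fin 24 → Bool) (a e : ℤ) {j : Fin 24} (hj : j.val < 16) :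
    |pvec S f a e j| ≤ |a| := by
  rw [pvec_apply_of_lt S f a e hj]
  split_ifs
  · rcases sgn_cases (f j) with h | h <;> rw [h] <;> simp
  · simp

/-- Pattern vectors with the same signs on `S` and the same axis value are equal. -/
theorem pvec_congr {S : Finset (Fin 24)} {f f' : Fin 24 → Bool} (h : ∀ j ∈ S, f j = f' j) (a e : ℤ) :
    pvec S f a e = pvec S f' a e := by
  funext j
  unfold pvec
  by_cases hj : j ∈ S
  · rw [if_pos hj, if_pos hj, h j hj]
  · rw [if_neg hj, if_neg hj]

/-! ### The inner-product formula -/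

/-- **Master formula.** For pattern vectors on cells,
`ip (pvec S f a e) (pvec S' f' a' e') = a a' (|S ∩ S'| - 2 D) + 2 e e'` with `D = #{j ∈ S ∩ S' : f j ≠ f' j}`. -/
theorem ip_pvec_pvec {S S' : Finset (Fin 24)} (hS : S ⊆ cells) (hS' : S' ⊆ cells) (f f' : Fin 24 → Bool)
    (a e a' e' : ℤ) :
    ip (pvec S f a e) (pvec S' f' a' e') =
      a * a' * (((S ∩ S').card : ℤ) - 2 * (((S ∩ S').filter fun j => (f j ^^ f' j) = true).card : ℤ)) +
        2 * e * e' := by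
  rw [ip_comm, ip_pvec, pvec_apply_16 hS', pvec_apply_17 hS']
  have h1 : ∀ j ∈ S, pvec S' f' a' e' j * (a * sgn (f j)) =
      if j ∈ S' then a * a' * sgn (f j ^^ f' j) else 0 := by
    intro j hj
    rw [pvec_apply_of_lt S' f' a' e' (mem_cells.mp (hS hj))]
    split_ifs with h
    · rw [← sgn_mul_sgn]; ring
    · simp
  rw [Finset.sum_congr rfl h1, Finset.sum_ite_mem, ← Finset.mul_sum, sum_sgn_finset]
  ring

/-- **Norm** of a pattern vector: `a² |S| + 2 e²`. -/
theorem ip_pvec_self {S : Finset (Fin 24)} (hS : S ⊆ cells) (f : Fin 24 → Bool) (a e : ℤ) :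
    ip (pvec S f a e) (pvec S f a e) = a * a * S.card + 2 * e * e := by
  rw [ip_pvec_pvec hS hS, Finset.inter_self]
  have : (S.filter fun j => (f j ^^ f j) = true) = ∅ := by ext j; simp
  rw [this, Finset.card_empty]; push_cast; ring

/-- **Intersection bound**: `ip ≤ a a' |S ∩ S'| + 2 e e'` (`a a' ≥ 0`). -/
theorem ip_pvec_pvec_le_inter {S S' : Finset (Fin 24)} (hS : S ⊆ cells) (hS' : S' ⊆ cells)
    (f f' : Fin 24 → Bool) {a a' : ℤ} (haa : 0 ≤ a * a') (e e' : ℤ) :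
    ip (pvec S f a e) (pvec S' f' a' e') ≤ a * a' * (S ∩ S').card + 2 * e * e' := by
  rw [ip_pvec_pvec hS hS']
  nlinarith [Nat.cast_nonneg (α := ℤ) (((S ∩ S').filter fun j => (f j ^^ f' j) = true).card)]

/-- **Same support, two odd patterns that differ somewhere**: they differ at `≥ 2` places, so
`ip ≤ a a' (|S| - 4) + 2 e e'` (`a a' ≥ 0`). -/
theorem ip_pvec_pvec_le_of_odd_odd {S : Finset (Fin 24)} (hS : S ⊆ cells) {f f' : Fin 24 → Bool}
    (hf : Odd (S.filter fun j => f j = true).card) (hf' : Odd (S.filter fun j => f' j = true).card)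
    (hne : ∃ j ∈ S, f j ≠ f' j) {a a' : ℤ} (haa : 0 ≤ a * a') (e e' : ℤ) :
    ip (pvec S f a e) (pvec S f' a' e') ≤ a * a' * ((S.card : ℤ) - 4) + 2 * e * e' := by
  rw [ip_pvec_pvec hS hS, Finset.inter_self]
  obtain ⟨m, hm⟩ := even_card_filter_xor_of_odd_finset hf hf'
  obtain ⟨j, hj, hfj⟩ := hne
  have hpos : 0 < (S.filter fun j => (f j ^^ f' j) = true).card := by
    apply Finset.card_pos.mpr
    refine ⟨j, Finset.mem_filter.mpr ⟨hj, ?_⟩⟩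
    cases h1 : f j <;> cases h2 : f' j <;> simp_all
  have h2 : (2 : ℤ) ≤ ((S.filter fun j => (f j ^^ f' j) = true).card : ℤ) := by push_cast [hm] at hpos ⊢; omega
  nlinarith

/-- **Odd pattern against an even one on a larger support**: they differ at `≥ 1` place, so
`ip ≤ a a' (|S| - 2) + 2 e e'` (`S ⊆ S'`, `a a' ≥ 0`). -/
theorem ip_pvec_pvec_le_of_odd_even {S S' : Finset (Fin 24)} (hSS' : S ⊆ S') (hS' : S' ⊆ cells)
    {f f' : Fin 24 → Bool} (hf : Odd (S.filter fun j => f j = true).card)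
    (hf' : Even (S.filter fun j => f' j = true).card) {a a' : ℤ} (haa : 0 ≤ a * a') (e e' : ℤ) :
    ip (pvec S f a e) (pvec S' f' a' e') ≤ a * a' * ((S.card : ℤ) - 2) + 2 * e * e' := by
  rw [ip_pvec_pvec (hSS'.trans hS') hS', Finset.inter_eq_left.mpr hSS']
  obtain ⟨m, hm⟩ := odd_card_filter_xor_finset hf hf'
  have h1 : (1 : ℤ) ≤ ((S.filter fun j => (f j ^^ f' j) = true).card : ℤ) := by push_cast [hm]; omega
  nlinarith

/-! ### All cells: the sign vector of a `16`-bit word -/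

/-- On all cells, the number of places where the signs of two words differ is the restricted weight of their
`XOR`. -/
theorem card_cells_filter_xor (c c' : ℕ) :
    ((cells ∩ cells).filter fun j : Fin 24 => (c.testBit j.val ^^ c'.testBit j.val) = true).card =
      wtK 16 (c ^^^ c') := by
  rw [Finset.inter_self, wtK, cells, Finset.filter_filter]
  congr 1; ext j; simp [Nat.testBit_xor]

/-- **Two all-cells sign vectors**: `ip = a a' (16 - 2 wtK₁₆ (c ⊕ c')) + 2 e e'`. -/
theorem ip_pvec_cells (c c' : ℕ) (a e a' e' : ℤ) :
    ip (pvec cells (fun j => c.testBit j.val) a e) (pvec cells (fun j => c'.testBit j.val) a' e') =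
      a * a' * (16 - 2 * (wtK 16 (c ^^^ c') : ℤ)) + 2 * e * e' := by
  rw [ip_pvec_pvec subset_rfl subset_rfl, card_cells_filter_xor, Finset.inter_self, card_cells]; rfl

/-- The number of minus signs of a word on a set of cells is the size of the intersection with its support. -/
theorem card_filter_testBit (S : Finset (Fin 24)) (c : ℕ) :
    (S.filter fun j : Fin 24 => c.testBit j.val = true).card = (S ∩ supp c).card := by
  congr 1; ext j; simp [supp]

/-! ### A two-cell pattern against anything small -/

/-- A pattern on a two-element cell set `{k, l}` against a vector with entries of absolute value `≤ b` on the
cells: `ip ≤ 2 |a| b` (used for shape `A` against shapes `B, X, D`). -/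
theorem ip_pvec_pair_le {k l : Fin 24} (hk : k.val < 16) (hl : l.val < 16) (hkl : k ≠ l) (f : Fin 24 → Bool)
    (a : ℤ) {x : Fin 24 → ℤ} {b : ℤ} (hxk : |x k| ≤ b) (hxl : |x l| ≤ b) :
    ip x (pvec {k, l} f a 0) ≤ 2 * |a| * b := by
  rw [ip_pvec, Finset.sum_pair hkl, zero_mul, add_zero]
  have h1 : ∀ (y : ℤ) (s : Bool), |y| ≤ b → y * (a * sgn s) ≤ |a| * b := by
    intro y s hy
    have : y * (a * sgn s) ≤ |y * (a * sgn s)| := le_abs_self _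
    rw [abs_mul, abs_mul] at this
    rcases sgn_cases s with h | h <;> rw [h] at this ⊢ <;> simp at this <;>
      nlinarith [abs_nonneg a, abs_nonneg y]
  have _ := hk; have _ := hl
  linarith [h1 (x k) (f k) hxk, h1 (x l) (f l) hxl]

end Summit.Ventures.PackingBounds.Config.CL17
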